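import Summits.Ventures.YMGap.RobustBall.StarKernelClusteringZd
import Summits.Ventures.YMGap.RobustBall.StarBoundaryDecayZdGeometric
import Summits.Ventures.YMGap.RobustBall.UniformLoopCorrelatorDecay
import HarnessLib

/-!
# Venture YMGap, track DS (seat ds-3) — «C-KMIX-STAR», Wilson-LOOP cells: the loop–loop (glueball) correlator of a finite volume with ANY
# boundary field, and the boundary-field independence of Wilson-loop expectations, `SU(2)`, `d = 4`, every `0 ≤ β_W ≤ 9/25`

HONEST FRAMING. WHAT THIS IS: a venture file (cell `pub-ymgap`, track DS, seat ds-3; theorems only, no `def`, no named fact): the Wilson-loop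
specialisations of `StarKernelClusteringZd.su2_wilson_kernel_clustering_star` and `StarBoundaryDecayZdGeometric.su2_wilson_boundary_star_geometric`
(a loop observable `W_γ = ½ Re tr U_γ = loopTerm 2 1 γ` is a Lipschitz cylinder on the `≤ |γ|` links of `γ` with constant `√2|γ|`,
`UniformLoopCorrelatorDecay.isLipschitzCylinder_loopTerm`):
* `su2_wilson_kernel_loop_clustering_star` — for every finite `Λ₀`, EVERY boundary field `η`, every depth function `φ` and closed walks `γ₁`
  (links in `Λ₀` at depth `≥ m`), `γ₂`: `|cov_{γ_{Λ₀}(·|η)}(W_{γ₁}, W_{γ₂})| ≤ 32 |γ₁|²|γ₂|² · R_G(β_W)^{min(⌊d(γ₁,γ₂)/4⌋, ⌊m/4⌋)}`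
  (compare `su2_wilson_kernel_loop_clustering_upTo_oneTwelfth`: `64|γ₁|²|γ₂|²·2^{−d}` for all volumes at `β_W ≤ 1/12`);
* `su2_wilson_loop_boundary_star_geometric` — for EVERY DLR state `μ`: `|⟨W_γ⟩_{γ_{Λ₀}(·|η)} − ⟨W_γ⟩_μ| ≤ 4|γ|² · R_G(β_W)^{⌊m/4⌋}`.
WHAT THIS IS NOT: interior form; strong-coupling LATTICE statements about finite-volume kernels of the Wilson action at `β_W ≤ 9/25`; nothing
about the area law, the continuum limit or the Clay Millennium problem.

References: the seat's `StarKernelClusteringZd.lean`, `StarBoundaryDecayZdGeometric.lean`, `KernelClusteringBall.lean` (the `1/12` cells);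
rb-p1's `UniformLoopCorrelatorDecay.lean`.
-/

noncomputable section

open MeasureTheory ProbabilityTheory Function Finset Real SimpleGraph
open scoped NNReal
open Literature.Probability.LatticeModels
open Literature.MathematicalPhysics.QuantumLattice
open Literature.MathematicalPhysics.QuantumFieldTheory hiding ZdEdge Site
open Literature.MathematicalPhysics.QuantumFieldTheory (walkEdges card_walkEdges_le_length)
open Summit.Ventures.YMGap.DSWindowZd
open Summit.Ventures.YMGap.StarWindowGauge (gaugeR gaugeR_lt_one_of_le)
open Summit.Ventures.YMGap.StarLemmaG (gaugeR_nonneg)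

namespace Summit.Ventures.YMGap.RobustBall

/-- **THE LOOP–LOOP (glueball) CORRELATOR OF A FINITE VOLUME WITH ANY BOUNDARY FIELD, `SU(2)`, `d = 4`, EVERY `0 ≤ β_W ≤ 9/25`**: for every finite
link volume `Λ₀`, EVERY boundary field `η`, every depth function `φ` of `Λ₀` and closed lattice walks `γ₁` (links in `Λ₀`, `φ ≥ m` on them), `γ₂`:
`|cov_{γ_{Λ₀}(·|η)}(W_{γ₁}, W_{γ₂})| ≤ 32 · |γ₁|² · |γ₂|² · R_G(β_W)^{min(⌊d(γ₁,γ₂)/4⌋, ⌊m/4⌋)}`, `W_γ = loopTerm 2 1 γ = ½ Re tr U_γ`. [folklore] -/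
theorem su2_wilson_kernel_loop_clustering_star {βW : ℝ} (h0 : 0 ≤ βW) (h : βW ≤ 9 / 25)
    (Λ₀ : Finset (ZdEdge 4)) (η : LGConfig 4 (SUN 2)) (φ : ZdEdge 4 → ℝ)
    (hφ : ∀ x y : ZdEdge 4, φ x ≤ φ y + ‖x.1 - y.1‖) (hφΛ : ∀ x, 0 < φ x → x ∈ Λ₀)
    {x₁ x₂ : Literature.Probability.LatticeModels.Site 4} (w₁ : (zdGraph 4).Walk x₁ x₁) (w₂ : (zdGraph 4).Walk x₂ x₂)
    (hΛ₁ : walkEdges w₁ ⊆ Λ₀) {m : ℝ} (hm : ∀ x ∈ walkEdges w₁, m ≤ φ x) :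
    |cov[loopTerm 2 1 w₁, loopTerm 2 1 w₂; ymSpecification (d := 4) (fundamentalRep (Fin 2)) (βW / 2) Λ₀ η]| ≤
      32 * (w₁.length : ℝ) ^ 2 * (w₂.length : ℝ) ^ 2 *
        gaugeR βW ^ (min (⌊setDistEdges (walkEdges w₁) (walkEdges w₂) / (4 : ℕ)⌋₊) (⌊m / (4 : ℕ)⌋₊)) := by
  have key := su2_wilson_kernel_clustering_star h0 h Λ₀ η φ hφ hφΛ (isLipschitzCylinder_loopTerm (N := 2) 1 w₁)
    (isLipschitzCylinder_loopTerm (N := 2) 1 w₂) hΛ₁ hm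
  refine key.trans ?_
  have hc₁ : ((walkEdges w₁).card : ℝ) ≤ w₁.length := by exact_mod_cast card_walkEdges_le_length w₁
  have hc₂ : ((walkEdges w₂).card : ℝ) ≤ w₂.length := by exact_mod_cast card_walkEdges_le_length w₂
  have h2 : Real.sqrt ((2 : ℕ) : ℝ) * Real.sqrt ((2 : ℕ) : ℝ) = 2 := Real.mul_self_sqrt (by norm_num)
  have hρ0 : 0 ≤ gaugeR βW := gaugeR_nonneg h0 (by linarith)
  set E := gaugeR βW ^ (min (⌊setDistEdges (walkEdges w₁) (walkEdges w₂) / (4 : ℕ)⌋₊) (⌊m / (4 : ℕ)⌋₊))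
  have hE : 0 ≤ E := pow_nonneg hρ0 _
  simp only [abs_one, one_mul]
  calc 16 * ((walkEdges w₁).card : ℝ) * ((walkEdges w₂).card : ℝ) *
        (Real.sqrt ((2 : ℕ) : ℝ) * (w₁.length : ℝ) * (Real.sqrt ((2 : ℕ) : ℝ) * (w₂.length : ℝ))) * E
      = 16 * (Real.sqrt ((2 : ℕ) : ℝ) * Real.sqrt ((2 : ℕ) : ℝ)) *
          (((walkEdges w₁).card : ℝ) * w₁.length) * (((walkEdges w₂).card : ℝ) * w₂.length) * E := by ring
    _ ≤ 16 * (Real.sqrt ((2 : ℕ) : ℝ) * Real.sqrt ((2 : ℕ) : ℝ)) *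
          ((w₁.length : ℝ) * w₁.length) * ((w₂.length : ℝ) * w₂.length) * E := by
        have h₁ : ((walkEdges w₁).card : ℝ) * w₁.length ≤ (w₁.length : ℝ) * w₁.length :=
          mul_le_mul_of_nonneg_right hc₁ (Nat.cast_nonneg _)
        have h₂ : ((walkEdges w₂).card : ℝ) * w₂.length ≤ (w₂.length : ℝ) * w₂.length :=
          mul_le_mul_of_nonneg_right hc₂ (Nat.cast_nonneg _)
        have hs : 0 ≤ 16 * (Real.sqrt ((2 : ℕ) : ℝ) * Real.sqrt ((2 : ℕ) : ℝ)) := by positivity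
        exact mul_le_mul_of_nonneg_right (mul_le_mul (mul_le_mul_of_nonneg_left h₁ hs) h₂ (by positivity) (by positivity)) hE
    _ = 32 * (w₁.length : ℝ) ^ 2 * (w₂.length : ℝ) ^ 2 * E := by rw [h2]; ring

/-- **On the box**: `Λ₀ =` links based in `box 4 M`, `γ₁` with links based in `box 4 M'`, `M' ≤ M`:
`|cov_{γ_{box M}(·|η)}(W_{γ₁}, W_{γ₂})| ≤ 32 |γ₁|²|γ₂|² · R_G(β_W)^{min(⌊d(γ₁,γ₂)/4⌋, ⌊(M+1−M')/4⌋)}`. [folklore] -/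
theorem su2_wilson_kernel_loop_clustering_star_box {βW : ℝ} (h0 : 0 ≤ βW) (h : βW ≤ 9 / 25) {M M' : ℕ} (hMM : M' ≤ M)
    (η : LGConfig 4 (SUN 2)) {x₁ x₂ : Literature.Probability.LatticeModels.Site 4}
    (w₁ : (zdGraph 4).Walk x₁ x₁) (w₂ : (zdGraph 4).Walk x₂ x₂)
    (hΛ₁ : walkEdges w₁ ⊆ (box 4 M') ×ˢ (Finset.univ : Finset (Fin 4))) :
    |cov[loopTerm 2 1 w₁, loopTerm 2 1 w₂; ymSpecification (d := 4) (fundamentalRep (Fin 2)) (βW / 2)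
        ((box 4 M) ×ˢ (Finset.univ : Finset (Fin 4))) η]| ≤
      32 * (w₁.length : ℝ) ^ 2 * (w₂.length : ℝ) ^ 2 *
        gaugeR βW ^ (min (⌊setDistEdges (walkEdges w₁) (walkEdges w₂) / (4 : ℕ)⌋₊) (⌊((M : ℝ) + 1 - M') / (4 : ℕ)⌋₊)) := by
  classical
  have hΛ₁' : walkEdges w₁ ⊆ (box 4 M) ×ˢ (Finset.univ : Finset (Fin 4)) := fun x hx => by
    have h1 := Finset.mem_product.1 (hΛ₁ hx)
    refine Finset.mem_product.2 ⟨mem_box.2 fun i => ?_, Finset.mem_univ _⟩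
    have := (mem_box.1 h1.1) i
    omega
  refine su2_wilson_kernel_loop_clustering_star h0 h _ η (fun x => (M : ℝ) + 1 - supNormZd x.1)
    (fun x y => ?_) (fun x hx => ?_) w₁ w₂ hΛ₁' (fun x hx => ?_)
  · have h1 := supNormZd_le_supNormZd_add_norm y.1 x.1
    rw [norm_sub_rev] at h1
    linarith
  · refine Finset.mem_product.2 ⟨mem_box.2 fun i => ?_, Finset.mem_univ _⟩
    have h1 : (supNormZd x.1 : ℝ) < M + 1 := by linarith
    have h1' : supNormZd x.1 < M + 1 := by exact_mod_cast h1
    have h3 := natAbs_le_supNormZd x.1 i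
    omega
  · have h1 := Finset.mem_product.1 (hΛ₁ hx)
    have h2 : supNormZd x.1 ≤ M' := supNormZd_le_iff.2 fun i => by
      have := (mem_box.1 h1.1) i
      omega
    have h3 : (supNormZd x.1 : ℝ) ≤ M' := by exact_mod_cast h2
    linarith

/-- **WILSON-LOOP EXPECTATIONS FORGET THE BOUNDARY FIELD AT THE GEOMETRIC STAR RATE, `SU(2)`, `d = 4`, EVERY `0 ≤ β_W ≤ 9/25`**: for every finite
`Λ₀`, EVERY boundary field `η`, EVERY DLR state `μ`, every depth function `φ` and every closed walk `γ` with links in `Λ₀` at depth `≥ m`: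
`|∫W_γ dγ_{Λ₀}(·|η) − ∫W_γ dμ| ≤ 4 |γ|² · R_G(β_W)^{⌊m/4⌋}` (compare the `1/12` cells of `WilsonLoopBoundaryDecay.lean`). [folklore] -/
theorem su2_wilson_loop_boundary_star_geometric {βW : ℝ} (h0 : 0 ≤ βW) (h : βW ≤ 9 / 25)
    {μ : Measure (LGConfig 4 (SUN 2))} (hμ : μ ∈ ymGibbsMeasures (d := 4) (fundamentalRep (Fin 2)) (βW / 2))
    (Λ₀ : Finset (ZdEdge 4)) (η : LGConfig 4 (SUN 2)) (φ : ZdEdge 4 → ℝ)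
    (hφ : ∀ x y : ZdEdge 4, φ x ≤ φ y + ‖x.1 - y.1‖) (hφΛ : ∀ x, 0 < φ x → x ∈ Λ₀)
    {x₀ : Literature.Probability.LatticeModels.Site 4} (w : (zdGraph 4).Walk x₀ x₀)
    (hΔ : walkEdges w ⊆ Λ₀) {m : ℝ} (hm : ∀ x ∈ walkEdges w, m ≤ φ x) :
    |(∫ U, loopTerm 2 1 w U ∂(ymSpecification (d := 4) (fundamentalRep (Fin 2)) (βW / 2) Λ₀ η)) - ∫ U, loopTerm 2 1 w U ∂μ| ≤
      4 * (w.length : ℝ) ^ 2 * gaugeR βW ^ ⌊m / (4 : ℕ)⌋₊ := by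
  have key := su2_wilson_boundary_star_geometric h0 h hμ Λ₀ η φ hφ hφΛ (isLipschitzCylinder_loopTerm (N := 2) 1 w) hΔ hm
  refine key.trans ?_
  have hc : ((walkEdges w).card : ℝ) ≤ w.length := by exact_mod_cast card_walkEdges_le_length w
  have h2 : Real.sqrt 2 * Real.sqrt ((2 : ℕ) : ℝ) = 2 := by
    rw [show ((2 : ℕ) : ℝ) = 2 by norm_num]; exact Real.mul_self_sqrt (by norm_num)
  have hρ0 : 0 ≤ gaugeR βW := gaugeR_nonneg h0 (by linarith)
  set E := gaugeR βW ^ ⌊m / (4 : ℕ)⌋₊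
  have hE : 0 ≤ E := pow_nonneg hρ0 _
  simp only [abs_one, one_mul]
  calc 2 * Real.sqrt 2 * (Real.sqrt ((2 : ℕ) : ℝ) * (w.length : ℝ)) * ((walkEdges w).card : ℝ) * E
      = 2 * (Real.sqrt 2 * Real.sqrt ((2 : ℕ) : ℝ)) * ((w.length : ℝ) * (walkEdges w).card) * E := by ring
    _ ≤ 2 * (Real.sqrt 2 * Real.sqrt ((2 : ℕ) : ℝ)) * ((w.length : ℝ) * w.length) * E := by
        have h₁ : (w.length : ℝ) * (walkEdges w).card ≤ (w.length : ℝ) * w.length :=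
          mul_le_mul_of_nonneg_left hc (Nat.cast_nonneg _)
        have hs : 0 ≤ 2 * (Real.sqrt 2 * Real.sqrt ((2 : ℕ) : ℝ)) := by positivity
        exact mul_le_mul_of_nonneg_right (mul_le_mul_of_nonneg_left h₁ hs) hE
    _ = 4 * (w.length : ℝ) ^ 2 * E := by rw [h2]; ring

end Summit.Ventures.YMGap.RobustBall

end
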